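import Summits.HodgeConjecture.HodgeConjecture.Theorems.F0P3cStCharTSCellFunAnnulusFormula        -- ★ B5 «CELL-FUNCTION ANNULUS FORMULA★» `integral_cellFun_sub_eq_smul_sub_setIntegral`
import Summits.HodgeConjecture.HodgeConjecture.Theorems.F0P3cStCharTSKeys3TorusConjBall          -- ★ (β) «TORUS-CONJ BALL★»: `measurableEmbedding_torusConj`, `image_torusConj_normBall`, `isCompact_normBall_of_chart`, §2 annulus differences
import Summits.HodgeConjecture.HodgeConjecture.Theorems.F0P3cStCharTSCellFunFarOut               -- ★ B4 «CELL FUNCTION FAR OUT★» `exists_toFun_weylElt_mul_eq_smul_toFun_one`; brings `neg_one_mem_normOneUnits`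
import Summits.HodgeConjecture.HodgeConjecture.Theorems.F0P3cStCharTSLocalRingNormCompactness    -- ★ DICT: `isCompact_setOf_prod_normAbs_heisZ_le`; brings `prod_normAbs_units_mul`, `continuous_prod_normAbs`, `prod_normAbs_eq_zero_iff`, `isUnit_iff_ne_zero_localRing`
import Summits.HodgeConjecture.HodgeConjecture.Theorems.F0P3U3PrincipalSeriesOpenCellTorusChar   -- ★ N1: `weylScalar_eq`; brings ★ T2 `map_torusConj_cmBorel_eq_modularCharacter_nnreal_smul`, ★ T3b `cmTorusCharPair_weylConj` ∕ `proj_cmBorel_weylConj` ∕ `weylConj_mem_cmBorel`, ★ G3-CM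
import HarnessLib

/-!
# F0 · P3c · line LH6 «StCharTS» — «ANNULUS DOCK★» FILE A (ROAD «KEYS3-ANALYTIC», brick B6b-DOCK part D2, §1–§3): on `U(Φ₃)(L⁺_v)`, `v` non-split, the cell integral of the Jacquet
# test vector `g₀(m) = δ_B^{-1/2}(m)·(m·f) − χ(m)·f` is `χ(m)·(∫_{K_{A/‖d₀‖²}} − ∫_{K_A}) F`; it VANISHES for `‖d₀‖ = 1` and is `−χ(m)·∫_{A/‖d₀‖² < nrm u₀₂ ≤ A} F` for `‖d₀‖ > 1`
# [Keys1984 §7 Thm. (1); Casselman1995 §6.3, Lemma 7.1.1 (a); BernsteinZelevinsky1977 §2.3, §5 (5.2); Rogawski1990 §1.10, §12.2 (3)]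

Cell `pub/hodgecm-mathlib`, crux H413 = `stmt-HodgeConjecture-24833` (lane `--supports … --as helper`), route HCCMUnconditional; seat F0P2-p01 (g26), D2 pen by the WORD (2) of
the ROAD «KEYS3-ANALYTIC» holder F0P2-p06 (g21) (2026-09-03T00:42:56Z; MEMO `F0/P2/F0P2-p06/g21/MEMO-KEYS3-analytic-road.v3` §1 «ANNULUS FORMULA»; LEAD F0P3a-plan (g16) T15-03).
THEOREMS ONLY (0 def ∕ 0 instance ∕ 0 notation ∕ 0 sorry); ★-only imports.  FILE B = `F0P3cStCharTSKeys3AnnulusShell` (§4–§7: ★ B4 far out, the SHELL integrand, the HEAD).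

WHAT.  `R = ∏_{w ∣ v} L_w` (ONE place above the non-split `v`), `σ = c ⊗ 1`, `G = U(Φ₃)(L⁺_v)`, `(B, T, N)` = ★ `cmBorelTriple L 3 v`, `w₀ ∈ G` of matrix `Φ₃`, `χ = (χ₁, χ₂)` = ★ `cmTorusCharPair`
with `wχ = χ` (`hw'`), `I = i_G(χ)` = ★ `cmPrincipalSeries L 3 v χ`, `f ∈ I` ANY section, `m = diag(d) ∈ T`, `μ` ANY Haar measure of `N(L⁺_v)`, `nrm b = ∏_{w′} |b_{w′}|` (★ DICT, inline),
`K_A = {u ∈ N : nrm u₀₂ ≤ A}`, and the TEST VECTOR `g₀(m) = δ_B^{-1/2}(m)·I(m) f − χ(m)·f` — the integrand of ★ D1 `F0P3cStCharTSKeys3SplitTestDatum`, same spelling.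
* §1 `toFun_one_sub_smul_normalizedInd` (generic `t`) ∕ `toFun_one_cellTestVector` (`g₀(m)(1) = 0`), `hasCompactSupport_cellFun_cellTestVector` (★ G3-CM), `continuous_norm_entry`,
  `isCompact_normBall` (★ (β) `isCompact_normBall_of_chart` ∘ ★ DICT), `exists_subset_normBall_of_isCompact`.
* §2 **`integral_cellFun_sub_eq_smul_sub_setIntegral_normBall`**: `∫_N g₀(m)(w₀ u) dμ = χ(m) • (∫_{K_{A/‖d₀‖²}} F − ∫_{K_A} F)`, `F(u) = f(w₀ u)`, whenever `tsupport ⊆ K_A` — ★ B5 at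
  `c = Ad(m⁻¹)` (★ (β) `measurableEmbedding_torusConj`, `image_torusConj_normBall`), `κ = Δ_B(m)` (★ T2), `s = δ^{1/2}(ʷm)·wχ(m)` (★ T3b), `a s κ = χ(m)` (★ `weylScalar_eq` + `hw'`).
* §3 **`integral_cellFun_sub_eq_zero_of_modulus_eq_one`** (`‖d₀‖ = 1` ⟹ `∫ g₀(m) = 0`: `c(K_A) = K_A`, no shell integral on the compact part of `T`) and
  **`integral_cellFun_sub_eq_neg_smul_setIntegral_annulus`** (`‖d₀‖ > 1` ⟹ for all large `A`, `∫ g₀(m) = −χ(m) • ∫_{A/‖d₀‖² < nrm u₀₂ ≤ A} F`, ★ (β) `setIntegral_ball_sub_setIntegral_ball_of_le`).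
HONEST LABEL: HC_CM is proved only modulo the 7 printed citations (2 remaining named inputs: hLiu418 = `stmt-HodgeConjecture-24832`, h413 = `stmt-HodgeConjecture-24833`) until rung 0
closes; count-neutral organ-level computation.

## References
* [Keys1984] D. Keys, *Principal series representations of special unitary groups over local fields*, Compositio Math. 51 (1984), §7 Thm. (1) p. 126.
* [Casselman1995] W. Casselman, *Introduction to the theory of admissible representations of p-adic reductive groups* (1995), §6.3, Lemma 7.1.1 (a).
* [BernsteinZelevinsky1977] I. N. Bernstein, A. V. Zelevinsky, Ann. Sci. ÉNS 10 (1977), §2.3, §5 (5.2).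
* [Rogawski1990] J. D. Rogawski, *Automorphic Representations of Unitary Groups in Three Variables*, Ann. of Math. Stud. 123 (1990), §1.10 p. 9, §12.2 (3) pp. 173–174.
-/

set_option autoImplicit false
-- the mandated namespace has the single-problem summit's repeated segment (`HodgeConjecture.HodgeConjecture`)
set_option linter.dupNamespace false

noncomputable section

open NumberField IsDedekindDomain MeasureTheory Topology Filter Set
open scoped Matrix MatrixGroups NNReal ENNReal
open Literature.NumberTheory.Automorphic Literature.NumberTheory.Automorphic.UnitaryGroup Literature.NumberTheory.Automorphic.UnitaryGroup.HeisRing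
open Literature.NumberTheory.GaloisRepresentations Literature.NumberTheory.GaloisRepresentations.IsNonarchimedeanLocalField
open Summit.HodgeConjecture.HodgeConjecture.Cruxes.H413.F0P3cStCharTSBigCellFactorisation
open Summit.HodgeConjecture.HodgeConjecture.Cruxes.H413.F0P3cStCharTSLocalRingNormDictionary
open Summit.HodgeConjecture.HodgeConjecture.Cruxes.H413.F0P3cStCharTSLocalRingNormCompactness
open Summit.HodgeConjecture.HodgeConjecture.Cruxes.H413.F0P3cStCharTSKeys3TorusConjBall
open Summit.HodgeConjecture.HodgeConjecture.Cruxes.H413.F0P2oBorelTorusModulus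
open Summit.HodgeConjecture.HodgeConjecture.Cruxes.H413.F0P3U3PrincipalSeriesOpenCellTorusChar

namespace Summit.HodgeConjecture.HodgeConjecture.Cruxes.H413.F0P3cStCharTSKeys3AnnulusDock

variable (L : Type) [Field L] [NumberField L] [IsCMField L] (v : HeightOneSpectrum (𝓞 ↥(maximalRealSubfield L)))
  (hns : ∀ w : PlacesOver L v, IsCMField.complexConj L • w.1 = w.1)
  (χ₁ : (LocalRing L v)ˣ →* ℂˣ) (χ₂ : ↥(normOneUnits (conjLocal L (IsCMField.complexConj L) v)) →* ℂˣ)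
  (w₀ : ↥(unitaryGroupOfForm (conjLocal L (IsCMField.complexConj L) v) (cmLocalForm L 3 v)))
  (hw₀ : Units.val (w₀ : GL (Fin 3) (LocalRing L v)) = cmLocalForm L 3 v)

/-! ## §1 The test vector `g₀(m)`: value at `1`, compact support of its cell function; the norm balls `K_A` of `N` -/

section GenericTest

variable {G : Type*} [Group G] [TopologicalSpace G] [IsTopologicalGroup G] (t : ParabolicTriple G) [LocallyCompactSpace ↥t.P] (χ : ↥t.M →* ℂˣ)

/-- **`g₀(m)(1) = 0` (generic parabolic triple, `ρ = i_P^G χ` = ★ `normalizedInd t (𝟙 ⊗ χ)`)**: `(ρ(m) f)(1) = f(m) = χ(m) δ_P^{1/2}(m) f(1)`, so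
`δ_P^{-1/2}(m)·(ρ(m)f)(1) − χ(m)·f(1) = 0` — the test vector lies in `ker ev₁`. [cite: BernsteinZelevinsky1977, §2.3] [cite: Casselman1995, §6.3] -/
theorem toFun_one_sub_smul_normalizedInd (m : ↥t.M)
    (f : Representation.SmoothInd t.P (Representation.twist (((Representation.trivial ℂ ↥t.M ℂ).twist χ).comp t.proj) (rootDeltaChar t.P))) :
    ((((rootDeltaChar t.P (Subgroup.inclusion t.M_le m))⁻¹ : ℂˣ) : ℂ) •
          Representation.normalizedInd t ((Representation.trivial ℂ ↥t.M ℂ).twist χ) (m : G) f - ((χ m : ℂˣ) : ℂ) • f).toFun 1 = 0 := by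
  have hproj : t.proj (Subgroup.inclusion t.M_le m) = m := Subtype.ext (t.proj_apply_of_mem_M _ m.2)
  have h1 : (Representation.normalizedInd t ((Representation.trivial ℂ ↥t.M ℂ).twist χ) (m : G) f).toFun 1 =
      f.toFun (1 * ((Subgroup.inclusion t.M_le m : ↥t.P) : G)) := rfl
  have h2 := f.toFun_subgroup_mul (Subgroup.inclusion t.M_le m) 1
  rw [mul_one] at h2
  rw [sub_eq_add_neg, Representation.SmoothInd.toFun_add, Representation.SmoothInd.toFun_smul, ← neg_one_smul ℂ (((χ m : ℂˣ) : ℂ) • f),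
    Representation.SmoothInd.toFun_smul, Representation.SmoothInd.toFun_smul, Pi.add_apply, Pi.smul_apply, Pi.smul_apply, Pi.smul_apply,
    h1, one_mul, h2, Representation.twist_apply, MonoidHom.comp_apply, Representation.twist_apply, Representation.trivial_apply, hproj,
    smul_eq_mul, smul_eq_mul, smul_eq_mul, smul_eq_mul, ← mul_assoc, ← Units.val_mul, inv_mul_cancel, Units.val_one, one_mul, neg_one_mul, add_neg_cancel]

end GenericTest

section TestVector

set_option synthInstance.maxHeartbeats 400000 in
set_option maxHeartbeats 4000000 in
-- statement over the `SmoothInd` carrier of ★ `cmPrincipalSeries` (class of ★ B4 ∕ ★ D1)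
/-- **`g₀(m)(1) = 0` on `U(Φ₃)(L⁺_v)`** (the generic lemma read on ★ `cmPrincipalSeries`, definitionally ★ `normalizedInd`). [cite: BernsteinZelevinsky1977, §2.3] [cite: Casselman1995, §6.3] -/
theorem toFun_one_cellTestVector (χ : ↥(torusU (conjLocal L (IsCMField.complexConj L) v) (cmLocalForm L 3 v)) →* ℂˣ)
    (m : ↥(cmBorelTriple L 3 v).M)
    (f : haveI := locallyCompactSpace_cmBorelU L 3 v
      Representation.SmoothInd (cmBorelTriple L 3 v).P
        (Representation.twist (((Representation.trivial ℂ ↥(torusU (conjLocal L (IsCMField.complexConj L) v) (cmLocalForm L 3 v)) ℂ).twist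
          χ).comp (cmBorelTriple L 3 v).proj) (rootDeltaChar (cmBorelTriple L 3 v).P))) :
    haveI := locallyCompactSpace_cmBorelU L 3 v
    ((((rootDeltaChar (cmBorelTriple L 3 v).P (Subgroup.inclusion (cmBorelTriple L 3 v).M_le m))⁻¹ : ℂˣ) : ℂ) •
          cmPrincipalSeries L 3 v χ (m : ↥(unitaryGroupOfForm (conjLocal L (IsCMField.complexConj L) v) (cmLocalForm L 3 v))) f -
        ((χ m : ℂˣ) : ℂ) • f).toFun 1 = 0 := by
  haveI := locallyCompactSpace_cmBorelU L 3 v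
  dsimp only [UnitaryGroup.cmPrincipalSeries, UnitaryGroup.principalSeries]
  exact toFun_one_sub_smul_normalizedInd (cmBorelTriple L 3 v) χ m f

set_option synthInstance.maxHeartbeats 400000 in
set_option maxHeartbeats 4000000 in
-- statement over the `SmoothInd` carrier of ★ `cmPrincipalSeries` (class of ★ B4 ∕ ★ D1)
include hns hw₀ in
/-- **The cell function of `g₀(m)` is compactly supported** (`v` non-split, `w₀` of matrix `Φ₃`): `g₀(m)(1) = 0` and ★ G3-CM `hasCompactSupport_cellFun_cmPrincipalSeries_three`.
[cite: Casselman1995, §6.3] [cite: BernsteinZelevinsky1977, §5 (5.2)] -/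
theorem hasCompactSupport_cellFun_cellTestVector (χ : ↥(torusU (conjLocal L (IsCMField.complexConj L) v) (cmLocalForm L 3 v)) →* ℂˣ)
    (m : ↥(cmBorelTriple L 3 v).M)
    (f : haveI := locallyCompactSpace_cmBorelU L 3 v
      Representation.SmoothInd (cmBorelTriple L 3 v).P
        (Representation.twist (((Representation.trivial ℂ ↥(torusU (conjLocal L (IsCMField.complexConj L) v) (cmLocalForm L 3 v)) ℂ).twist
          χ).comp (cmBorelTriple L 3 v).proj) (rootDeltaChar (cmBorelTriple L 3 v).P))) :
    haveI := locallyCompactSpace_cmBorelU L 3 v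
    HasCompactSupport fun u : ↥(cmBorelTriple L 3 v).N =>
      ((((rootDeltaChar (cmBorelTriple L 3 v).P (Subgroup.inclusion (cmBorelTriple L 3 v).M_le m))⁻¹ : ℂˣ) : ℂ) •
            cmPrincipalSeries L 3 v χ (m : ↥(unitaryGroupOfForm (conjLocal L (IsCMField.complexConj L) v) (cmLocalForm L 3 v))) f -
          ((χ m : ℂˣ) : ℂ) • f).toFun
        ((w₀ : ↥(unitaryGroupOfForm (conjLocal L (IsCMField.complexConj L) v) (cmLocalForm L 3 v))) * u) :=
  haveI := locallyCompactSpace_cmBorelU L 3 v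
  hasCompactSupport_cellFun_cmPrincipalSeries_three L v hns χ w₀ hw₀ _ (toFun_one_cellTestVector L v χ m f)

/-- **`u ↦ nrm u₀₂` is continuous on `N`** (`nrm = ∏_{w′} |·|_{w′}` ★ `continuous_prod_normAbs`, the entry is continuous). [cite: Rogawski1990, §1.10 p. 9] -/
theorem continuous_norm_entry :
    Continuous fun u : ↥(cmBorelTriple L 3 v).N =>
      ((∏ w' : PlacesOver L v, normAbs (w'.1.adicCompletion L)
        (((((u : ↥(unitaryGroupOfForm (conjLocal L (IsCMField.complexConj L) v) (cmLocalForm L 3 v))) : GL (Fin 3) (LocalRing L v)) :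
          Matrix (Fin 3) (Fin 3) (LocalRing L v)) 0 2) w') : ℝ≥0) : ℝ) := by
  have hent : Continuous fun u : ↥(cmBorelTriple L 3 v).N =>
      ((((u : ↥(unitaryGroupOfForm (conjLocal L (IsCMField.complexConj L) v) (cmLocalForm L 3 v))) : GL (Fin 3) (LocalRing L v)) :
        Matrix (Fin 3) (Fin 3) (LocalRing L v)) 0 2) :=
    ((Units.continuous_val.comp continuous_subtype_val).matrix_elem 0 2).comp continuous_subtype_val
  exact NNReal.continuous_coe.comp ((continuous_prod_normAbs L v).comp hent)

include hns in
/-- **The norm ball `K_A = {u ∈ N : nrm u₀₂ ≤ A}` is compact** at a non-split `v` (★ (β) `isCompact_normBall_of_chart` ∘ ★ DICT `isCompact_setOf_prod_normAbs_heisZ_le`).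
[cite: Rogawski1990, §1.10 p. 9] [cite: Casselman1995, §6.3] -/
theorem isCompact_normBall (A : ℝ) :
    IsCompact {u : ↥(cmBorelTriple L 3 v).N |
      ((∏ w' : PlacesOver L v, normAbs (w'.1.adicCompletion L)
        (((((u : ↥(unitaryGroupOfForm (conjLocal L (IsCMField.complexConj L) v) (cmLocalForm L 3 v))) : GL (Fin 3) (LocalRing L v)) :
          Matrix (Fin 3) (Fin 3) (LocalRing L v)) 0 2) w') : ℝ≥0) : ℝ) ≤ A} := by
  obtain ⟨w⟩ : Nonempty (PlacesOver L v) := inferInstance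
  have hw := hns w
  letI : Invertible (2 : LocalRing L v) := (isUnit_two_localRing L v).invertible
  exact isCompact_normBall_of_chart (conjLocal L (IsCMField.complexConj L) v) (conjLocal_conjLocal_cm L v) (continuous_conjLocal L (IsCMField.complexConj L) v)
    (cmLocalForm_eq_over L 3 v) (nrm := fun b : LocalRing L v => ∏ w' : PlacesOver L v, normAbs (w'.1.adicCompletion L) (b w'))
    (isCompact_setOf_prod_normAbs_heisZ_le L v w hw A)

/-- **A compact subset of `N` lies in all large norm balls**: `C ⊆ K_A` for every `A ≥ A₁(C)` (`u ↦ nrm u₀₂` is continuous, hence bounded on `C`). [cite: Casselman1995, §6.3] -/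
theorem exists_subset_normBall_of_isCompact {C : Set ↥(cmBorelTriple L 3 v).N} (hC : IsCompact C) :
    ∃ A₁ : ℝ, ∀ A : ℝ, A₁ ≤ A → C ⊆ {u : ↥(cmBorelTriple L 3 v).N |
      ((∏ w' : PlacesOver L v, normAbs (w'.1.adicCompletion L)
        (((((u : ↥(unitaryGroupOfForm (conjLocal L (IsCMField.complexConj L) v) (cmLocalForm L 3 v))) : GL (Fin 3) (LocalRing L v)) :
          Matrix (Fin 3) (Fin 3) (LocalRing L v)) 0 2) w') : ℝ≥0) : ℝ) ≤ A} := by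
  obtain ⟨A₁, hA₁⟩ := (hC.image (continuous_norm_entry L v)).bddAbove
  exact ⟨A₁, fun A hA u hu => le_trans (hA₁ ⟨u, hu, rfl⟩) hA⟩

end TestVector

/-! ## §2 The annulus formula on norm balls: `∫_N g₀(m)(w₀ u) dμ = χ(m) • (∫_{K_{A/‖d₀‖²}} F − ∫_{K_A} F)` -/

section NormBall

variable [MeasurableSpace ↥(cmBorelTriple L 3 v).N] [BorelSpace ↥(cmBorelTriple L 3 v).N] (μ : Measure ↥(cmBorelTriple L 3 v).N) [μ.IsHaarMeasure]

include hns hw₀ in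
set_option synthInstance.maxHeartbeats 400000 in
set_option maxHeartbeats 8000000 in
-- statement∕proof over the `SmoothInd` carrier of ★ `cmPrincipalSeries` (class of ★ N1 ∕ ★ B5's consumer)
/-- **«ANNULUS FORMULA ON NORM BALLS».**  `v` non-split, `wχ = χ`, `m = diag(d) ∈ T`, `f ∈ i_G(χ₁, χ₂)` any section, `μ` any Haar measure of `N(L⁺_v)`, `A` with `tsupport(cellFun g₀(m)) ⊆ K_A`:
  `∫_N g₀(m)(w₀ u) dμ(u) = χ(m) • ( ∫_{K_{A/‖d₀‖²}} f(w₀ u) dμ − ∫_{K_A} f(w₀ u) dμ )`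
— ★ B5 `integral_cellFun_sub_eq_smul_sub_setIntegral` with `c = Ad(m⁻¹)` (★ (β) `measurableEmbedding_torusConj`, `c(K_A) = K_{A/‖d₀‖²}` ★ (β) `image_torusConj_normBall`), `κ = Δ_B(m)` (★ T2),
`s = δ_B^{1/2}(ʷm)·wχ(m)` (★ T3b) and `a·s·κ = χ(m)` (★ `weylScalar_eq` + `wχ = χ`). [cite: Casselman1995, §6.3, Lemma 7.1.1 (a)] [cite: BernsteinZelevinsky1977, §5 (5.2)] [cite: Keys1984, §7 Thm. (1)] -/
theorem integral_cellFun_sub_eq_smul_sub_setIntegral_normBall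
    (hw' : cmWeylTorusCharPair L v χ₁ χ₂ = cmTorusCharPair L v χ₁ χ₂)
    (m : ↥(cmBorelTriple L 3 v).M) {d : Fin 3 → (LocalRing L v)ˣ}
    (hd : glDiagonal 3 (LocalRing L v) d =
      (((m : ↥(unitaryGroupOfForm (conjLocal L (IsCMField.complexConj L) v) (cmLocalForm L 3 v))) : GL (Fin 3) (LocalRing L v))))
    (f : haveI := locallyCompactSpace_cmBorelU L 3 v
      Representation.SmoothInd (cmBorelTriple L 3 v).P
        (Representation.twist (((Representation.trivial ℂ ↥(torusU (conjLocal L (IsCMField.complexConj L) v) (cmLocalForm L 3 v)) ℂ).twist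
          (cmTorusCharPair L v χ₁ χ₂)).comp (cmBorelTriple L 3 v).proj) (rootDeltaChar (cmBorelTriple L 3 v).P)))
    {A : ℝ}
    (hsupp : haveI := locallyCompactSpace_cmBorelU L 3 v
      tsupport (fun u : ↥(cmBorelTriple L 3 v).N =>
        ((((rootDeltaChar (cmBorelTriple L 3 v).P (Subgroup.inclusion (cmBorelTriple L 3 v).M_le m))⁻¹ : ℂˣ) : ℂ) •
              cmPrincipalSeries L 3 v (cmTorusCharPair L v χ₁ χ₂) (m : ↥(unitaryGroupOfForm (conjLocal L (IsCMField.complexConj L) v) (cmLocalForm L 3 v))) f -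
            ((cmTorusCharPair L v χ₁ χ₂ m : ℂˣ) : ℂ) • f).toFun
          ((w₀ : ↥(unitaryGroupOfForm (conjLocal L (IsCMField.complexConj L) v) (cmLocalForm L 3 v))) * u)) ⊆
      {u : ↥(cmBorelTriple L 3 v).N |
        ((∏ w' : PlacesOver L v, normAbs (w'.1.adicCompletion L)
          (((((u : ↥(unitaryGroupOfForm (conjLocal L (IsCMField.complexConj L) v) (cmLocalForm L 3 v))) : GL (Fin 3) (LocalRing L v)) :
            Matrix (Fin 3) (Fin 3) (LocalRing L v)) 0 2) w') : ℝ≥0) : ℝ) ≤ A}) :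
    haveI := locallyCompactSpace_cmBorelU L 3 v
    ∫ u : ↥(cmBorelTriple L 3 v).N,
        ((((rootDeltaChar (cmBorelTriple L 3 v).P (Subgroup.inclusion (cmBorelTriple L 3 v).M_le m))⁻¹ : ℂˣ) : ℂ) •
              cmPrincipalSeries L 3 v (cmTorusCharPair L v χ₁ χ₂) (m : ↥(unitaryGroupOfForm (conjLocal L (IsCMField.complexConj L) v) (cmLocalForm L 3 v))) f -
            ((cmTorusCharPair L v χ₁ χ₂ m : ℂˣ) : ℂ) • f).toFun
          ((w₀ : ↥(unitaryGroupOfForm (conjLocal L (IsCMField.complexConj L) v) (cmLocalForm L 3 v))) * u) ∂μ =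
      ((cmTorusCharPair L v χ₁ χ₂ m : ℂˣ) : ℂ) •
        ((∫ u in {u : ↥(cmBorelTriple L 3 v).N |
            ((∏ w' : PlacesOver L v, normAbs (w'.1.adicCompletion L)
              (((((u : ↥(unitaryGroupOfForm (conjLocal L (IsCMField.complexConj L) v) (cmLocalForm L 3 v))) : GL (Fin 3) (LocalRing L v)) :
                Matrix (Fin 3) (Fin 3) (LocalRing L v)) 0 2) w') : ℝ≥0) : ℝ) ≤ A / ((distribHaarChar (LocalRing L v) (d 0) : ℝ) ^ 2)},
            f.toFun ((w₀ : ↥(unitaryGroupOfForm (conjLocal L (IsCMField.complexConj L) v) (cmLocalForm L 3 v))) * u) ∂μ) -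
          ∫ u in {u : ↥(cmBorelTriple L 3 v).N |
            ((∏ w' : PlacesOver L v, normAbs (w'.1.adicCompletion L)
              (((((u : ↥(unitaryGroupOfForm (conjLocal L (IsCMField.complexConj L) v) (cmLocalForm L 3 v))) : GL (Fin 3) (LocalRing L v)) :
                Matrix (Fin 3) (Fin 3) (LocalRing L v)) 0 2) w') : ℝ≥0) : ℝ) ≤ A},
            f.toFun ((w₀ : ↥(unitaryGroupOfForm (conjLocal L (IsCMField.complexConj L) v) (cmLocalForm L 3 v))) * u) ∂μ) := by
  haveI := locallyCompactSpace_cmBorelU L 3 v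
  letI : MeasurableSpace (LocalRing L v) := borel _
  haveI : BorelSpace (LocalRing L v) := ⟨rfl⟩
  have hσ := conjLocal_conjLocal_cm L v
  have hσc := continuous_conjLocal L (IsCMField.complexConj L) v
  have hJ := cmLocalForm_eq_over L 3 v
  -- the data of ★ B5: `ʷm ∈ B`, `n m = m (m⁻¹ n m)`, `μ.map (m⁻¹ · m) = Δ_B(m) • μ`, `τ(ʷm) = δ^{1/2}(ʷm) wχ(m)`
  have hm := weylConj_mem_cmBorel L v w₀ hw₀ m
  have hc : ∀ n : ↥(cmBorelTriple L 3 v).N,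
      (n : ↥(unitaryGroupOfForm (conjLocal L (IsCMField.complexConj L) v) (cmLocalForm L 3 v))) *
          (m : ↥(unitaryGroupOfForm (conjLocal L (IsCMField.complexConj L) v) (cmLocalForm L 3 v))) =
        (m : ↥(unitaryGroupOfForm (conjLocal L (IsCMField.complexConj L) v) (cmLocalForm L 3 v))) *
          (torusConj (conjLocal L (IsCMField.complexConj L) v) m n : ↥(unitaryGroupOfForm (conjLocal L (IsCMField.complexConj L) v) (cmLocalForm L 3 v))) := by
    intro n
    rw [coe_torusConj, ← mul_assoc, ← mul_assoc, mul_inv_cancel, one_mul]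
  have hμ := map_torusConj_cmBorel_eq_modularCharacter_nnreal_smul L v m μ
  have hs : ∀ c : ℂ,
      (Representation.twist
          (((Representation.trivial ℂ ↥(torusU (conjLocal L (IsCMField.complexConj L) v) (cmLocalForm L 3 v)) ℂ).twist
            (cmTorusCharPair L v χ₁ χ₂)).comp (cmBorelTriple L 3 v).proj) (rootDeltaChar (cmBorelTriple L 3 v).P))
          ⟨w₀ * (m : ↥(unitaryGroupOfForm (conjLocal L (IsCMField.complexConj L) v) (cmLocalForm L 3 v))) * w₀⁻¹, hm⟩ c =
        ((((rootDeltaChar (cmBorelTriple L 3 v).P ⟨w₀ * (m : ↥(unitaryGroupOfForm (conjLocal L (IsCMField.complexConj L) v) (cmLocalForm L 3 v))) * w₀⁻¹, hm⟩ : ℂˣ) : ℂ)) *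
            ((cmWeylTorusCharPair L v χ₁ χ₂ m : ℂˣ) : ℂ)) • c := by
    intro c
    rw [Representation.twist_apply, MonoidHom.comp_apply, Representation.twist_apply, Representation.trivial_apply,
      proj_cmBorel_weylConj L v w₀ hw₀ m, cmTorusCharPair_weylConj L v w₀ hw₀ χ₁ χ₂ m, smul_smul]
  have hθ := weylScalar_eq L v w₀ hw₀ χ₁ χ₂ m
  have hwm : ((cmWeylTorusCharPair L v χ₁ χ₂ m : ℂˣ) : ℂ) = ((cmTorusCharPair L v χ₁ χ₂ m : ℂˣ) : ℂ) := by rw [hw']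
  -- the ball `K_A` is compact and `c(K_A) = K_{A/‖d₀‖²}`
  have hK := isCompact_normBall L v hns A
  have himage := image_torusConj_normBall (conjLocal L (IsCMField.complexConj L) v) hσ hσc hJ
    (nrm := fun b : LocalRing L v => ∏ w' : PlacesOver L v, normAbs (w'.1.adicCompletion L) (b w')) (prod_normAbs_units_mul L v) m hd A
  -- unfold ★ `cmPrincipalSeries` to the `smoothIndRep` spelling of ★ B5
  dsimp only [UnitaryGroup.cmPrincipalSeries, UnitaryGroup.principalSeries, Representation.normalizedInd] at hsupp ⊢
  have h5 := F0P3cStCharTSCellFunAnnulusFormula.integral_cellFun_sub_eq_smul_sub_setIntegral (cmBorelTriple L 3 v).P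
    (Representation.twist
      (((Representation.trivial ℂ ↥(torusU (conjLocal L (IsCMField.complexConj L) v) (cmLocalForm L 3 v)) ℂ).twist
        (cmTorusCharPair L v χ₁ χ₂)).comp (cmBorelTriple L 3 v).proj) (rootDeltaChar (cmBorelTriple L 3 v).P))
    (cmBorelTriple L 3 v).N.subtype w₀ μ continuous_subtype_val
    (m : ↥(unitaryGroupOfForm (conjLocal L (IsCMField.complexConj L) v) (cmLocalForm L 3 v))) hm
    (torusConj (conjLocal L (IsCMField.complexConj L) v) m) (continuous_torusConj (conjLocal L (IsCMField.complexConj L) v) m)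
    (measurableEmbedding_torusConj (conjLocal L (IsCMField.complexConj L) v) m) hc hμ hs f
    (a := (((rootDeltaChar (cmBorelTriple L 3 v).P (Subgroup.inclusion (cmBorelTriple L 3 v).M_le m))⁻¹ : ℂˣ) : ℂ))
    (b := ((cmTorusCharPair L v χ₁ χ₂ m : ℂˣ) : ℂ)) (by linear_combination hθ + hwm) hK
    (fun u hu => hsupp (subset_tsupport _ hu))
  rw [himage] at h5
  simpa only [Subgroup.coe_subtype] using h5

end NormBall

/-! ## §3 `‖d₀‖ = 1`: the cell integral vanishes; `‖d₀‖ > 1`: it is `−χ(m) •` the annulus integral -/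

section Annulus

variable [MeasurableSpace ↥(cmBorelTriple L 3 v).N] [BorelSpace ↥(cmBorelTriple L 3 v).N] (μ : Measure ↥(cmBorelTriple L 3 v).N) [μ.IsHaarMeasure]

include hns hw₀ in
set_option synthInstance.maxHeartbeats 400000 in
set_option maxHeartbeats 8000000 in
-- statement∕proof over the `SmoothInd` carrier of ★ `cmPrincipalSeries` (class of ★ N1)
/-- **`‖d₀‖ = 1` ⟹ `∫_N g₀(m)(w₀ u) dμ = 0`**: then `c(K_A) = K_A` and the two ball integrals of §2 cancel (no shell integral is needed on the compact part of `T`).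
[cite: Keys1984, §7 Thm. (1)] [cite: Casselman1995, §6.3] -/
theorem integral_cellFun_sub_eq_zero_of_modulus_eq_one
    (hw' : cmWeylTorusCharPair L v χ₁ χ₂ = cmTorusCharPair L v χ₁ χ₂)
    (m : ↥(cmBorelTriple L 3 v).M) {d : Fin 3 → (LocalRing L v)ˣ}
    (hd : glDiagonal 3 (LocalRing L v) d =
      (((m : ↥(unitaryGroupOfForm (conjLocal L (IsCMField.complexConj L) v) (cmLocalForm L 3 v))) : GL (Fin 3) (LocalRing L v))))
    (h1 : distribHaarChar (LocalRing L v) (d 0) = 1)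
    (f : haveI := locallyCompactSpace_cmBorelU L 3 v
      Representation.SmoothInd (cmBorelTriple L 3 v).P
        (Representation.twist (((Representation.trivial ℂ ↥(torusU (conjLocal L (IsCMField.complexConj L) v) (cmLocalForm L 3 v)) ℂ).twist
          (cmTorusCharPair L v χ₁ χ₂)).comp (cmBorelTriple L 3 v).proj) (rootDeltaChar (cmBorelTriple L 3 v).P))) :
    haveI := locallyCompactSpace_cmBorelU L 3 v
    ∫ u : ↥(cmBorelTriple L 3 v).N,
        ((((rootDeltaChar (cmBorelTriple L 3 v).P (Subgroup.inclusion (cmBorelTriple L 3 v).M_le m))⁻¹ : ℂˣ) : ℂ) •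
              cmPrincipalSeries L 3 v (cmTorusCharPair L v χ₁ χ₂) (m : ↥(unitaryGroupOfForm (conjLocal L (IsCMField.complexConj L) v) (cmLocalForm L 3 v))) f -
            ((cmTorusCharPair L v χ₁ χ₂ m : ℂˣ) : ℂ) • f).toFun
          ((w₀ : ↥(unitaryGroupOfForm (conjLocal L (IsCMField.complexConj L) v) (cmLocalForm L 3 v))) * u) ∂μ = 0 := by
  haveI := locallyCompactSpace_cmBorelU L 3 v
  obtain ⟨A₁, hA₁⟩ := exists_subset_normBall_of_isCompact L v (hasCompactSupport_cellFun_cellTestVector L v hns w₀ hw₀ (cmTorusCharPair L v χ₁ χ₂) m f)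
  rw [integral_cellFun_sub_eq_smul_sub_setIntegral_normBall L v hns χ₁ χ₂ w₀ hw₀ μ hw' m hd f (hA₁ A₁ le_rfl), h1, NNReal.coe_one, one_pow, div_one,
    sub_self, smul_zero]

include hns hw₀ in
set_option synthInstance.maxHeartbeats 400000 in
set_option maxHeartbeats 8000000 in
-- statement∕proof over the `SmoothInd` carrier of ★ `cmPrincipalSeries` (class of ★ N1)
/-- **`‖d₀‖ > 1` ⟹ for all large `A`, `∫_N g₀(m)(w₀ u) dμ = −χ(m) • ∫_{A/‖d₀‖² < nrm u₀₂ ≤ A} f(w₀ u) dμ(u)`** (§2 and ★ (β) `setIntegral_ball_sub_setIntegral_ball_of_le`; «large» =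
`A ≥ 0` and `tsupport(cellFun g₀(m)) ⊆ K_A`). [cite: Keys1984, §7 Thm. (1)] [cite: Casselman1995, §6.3, Lemma 7.1.1 (a)] [cite: Rogawski1990, §12.2 (3) p. 174] -/
theorem integral_cellFun_sub_eq_neg_smul_setIntegral_annulus
    (hw' : cmWeylTorusCharPair L v χ₁ χ₂ = cmTorusCharPair L v χ₁ χ₂)
    (m : ↥(cmBorelTriple L 3 v).M) {d : Fin 3 → (LocalRing L v)ˣ}
    (hd : glDiagonal 3 (LocalRing L v) d =
      (((m : ↥(unitaryGroupOfForm (conjLocal L (IsCMField.complexConj L) v) (cmLocalForm L 3 v))) : GL (Fin 3) (LocalRing L v))))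
    (hQ : 1 < distribHaarChar (LocalRing L v) (d 0))
    (f : haveI := locallyCompactSpace_cmBorelU L 3 v
      Representation.SmoothInd (cmBorelTriple L 3 v).P
        (Representation.twist (((Representation.trivial ℂ ↥(torusU (conjLocal L (IsCMField.complexConj L) v) (cmLocalForm L 3 v)) ℂ).twist
          (cmTorusCharPair L v χ₁ χ₂)).comp (cmBorelTriple L 3 v).proj) (rootDeltaChar (cmBorelTriple L 3 v).P))) :
    haveI := locallyCompactSpace_cmBorelU L 3 v
    ∃ A₁ : ℝ, ∀ A : ℝ, A₁ ≤ A →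
      ∫ u : ↥(cmBorelTriple L 3 v).N,
          ((((rootDeltaChar (cmBorelTriple L 3 v).P (Subgroup.inclusion (cmBorelTriple L 3 v).M_le m))⁻¹ : ℂˣ) : ℂ) •
                cmPrincipalSeries L 3 v (cmTorusCharPair L v χ₁ χ₂) (m : ↥(unitaryGroupOfForm (conjLocal L (IsCMField.complexConj L) v) (cmLocalForm L 3 v))) f -
              ((cmTorusCharPair L v χ₁ χ₂ m : ℂˣ) : ℂ) • f).toFun
            ((w₀ : ↥(unitaryGroupOfForm (conjLocal L (IsCMField.complexConj L) v) (cmLocalForm L 3 v))) * u) ∂μ =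
        -(((cmTorusCharPair L v χ₁ χ₂ m : ℂˣ) : ℂ) •
          ∫ u in (fun u : ↥(cmBorelTriple L 3 v).N =>
              ((∏ w' : PlacesOver L v, normAbs (w'.1.adicCompletion L)
                (((((u : ↥(unitaryGroupOfForm (conjLocal L (IsCMField.complexConj L) v) (cmLocalForm L 3 v))) : GL (Fin 3) (LocalRing L v)) :
                  Matrix (Fin 3) (Fin 3) (LocalRing L v)) 0 2) w') : ℝ≥0) : ℝ)) ⁻¹' Set.Ioc (A / ((distribHaarChar (LocalRing L v) (d 0) : ℝ) ^ 2)) A,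
            f.toFun ((w₀ : ↥(unitaryGroupOfForm (conjLocal L (IsCMField.complexConj L) v) (cmLocalForm L 3 v))) * u) ∂μ) := by
  haveI := locallyCompactSpace_cmBorelU L 3 v
  obtain ⟨A₁, hA₁⟩ := exists_subset_normBall_of_isCompact L v (hasCompactSupport_cellFun_cellTestVector L v hns w₀ hw₀ (cmTorusCharPair L v χ₁ χ₂) m f)
  refine ⟨max A₁ 0, fun A hA => ?_⟩
  have hA0 : 0 ≤ A := le_trans (le_max_right _ _) hA
  have hBA : A / ((distribHaarChar (LocalRing L v) (d 0) : ℝ) ^ 2) ≤ A :=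
    div_le_self hA0 (one_le_pow₀ (le_of_lt (by exact_mod_cast hQ)))
  -- `F = cellFun f` is continuous, hence integrable on the compact ball `K_A`
  have hF : IntegrableOn (fun u : ↥(cmBorelTriple L 3 v).N =>
      f.toFun ((w₀ : ↥(unitaryGroupOfForm (conjLocal L (IsCMField.complexConj L) v) (cmLocalForm L 3 v))) * u))
      {u : ↥(cmBorelTriple L 3 v).N |
        ((∏ w' : PlacesOver L v, normAbs (w'.1.adicCompletion L)
          (((((u : ↥(unitaryGroupOfForm (conjLocal L (IsCMField.complexConj L) v) (cmLocalForm L 3 v))) : GL (Fin 3) (LocalRing L v)) :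
            Matrix (Fin 3) (Fin 3) (LocalRing L v)) 0 2) w') : ℝ≥0) : ℝ) ≤ A} μ := by
    have hcont := SmoothInd.continuous_cellFun (cmBorelTriple L 3 v).P
      (Representation.twist
        (((Representation.trivial ℂ ↥(torusU (conjLocal L (IsCMField.complexConj L) v) (cmLocalForm L 3 v)) ℂ).twist
          (cmTorusCharPair L v χ₁ χ₂)).comp (cmBorelTriple L 3 v).proj) (rootDeltaChar (cmBorelTriple L 3 v).P))
      (cmBorelTriple L 3 v).N.subtype (w₀ : ↥(unitaryGroupOfForm (conjLocal L (IsCMField.complexConj L) v) (cmLocalForm L 3 v))) continuous_subtype_val f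
    simp only [Subgroup.coe_subtype] at hcont
    exact hcont.continuousOn.integrableOn_compact (isCompact_normBall L v hns A)
  rw [integral_cellFun_sub_eq_smul_sub_setIntegral_normBall L v hns χ₁ χ₂ w₀ hw₀ μ hw' m hd f (hA₁ A (le_trans (le_max_left _ _) hA)),
    setIntegral_ball_sub_setIntegral_ball_of_le μ (continuous_norm_entry L v).measurable _ hBA hF, smul_neg]

end Annulus

end Summit.HodgeConjecture.HodgeConjecture.Cruxes.H413.F0P3cStCharTSKeys3AnnulusDock

end
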